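import Literature.AlgebraicGeometry.Motives.PrymVariety
import Literature.AlgebraicGeometry.Motives.Jacobian
import Literature.AlgebraicGeometry.HodgeTheory.RationalHodgeClasses
import Literature.AlgebraicGeometry.HodgeTheory.WeilClasses
import Literature.AlgebraicGeometry.HodgeTheory.GysinFormalism
import HarnessLib

/-!
# The Hecke–Prym of an étale `F₂₁`-cover of a genus-3 curve: a `ℚ(√-7)`-Weil twelvefold of type `(6,6)` (named fact)

Let `C → C'` be an étale Galois cover of a complex genus-3 curve with group the Frobenius group
`F₂₁ = ℤ/7 ⋊ μ₃ = ⟨σ, τ | σ⁷ = τ³ = 1, τστ⁻¹ = σ²⟩` (it exists by Riemann's existence theorem: the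
fundamental group of `C'`, with its presentation `⟨a₁, b₁, a₂, b₂, a₃, b₃ | ∏[aᵢ, bᵢ]⟩`, surjects onto
`F₂₁` by `a₁ ↦ σ`, `a₂ ↦ τ`, the other generators `↦ 1`; [SGA1, Exp. XII Thm. 5.1, Cor. 5.2]), so
`g(C) = 1 + 21·2 = 43`. With `s = σ_*`, `t = τ_*` on `J = J(C)`, `N = ⟨σ⟩`, the Prym
`B = (ker Σ_{i<7} sⁱ)⁰ = Prym(C → C/N)` of the cyclic étale cover of degree `7` over the genus-7 curve
`C/N` has dimension `36` ([LangeRodriguez2022, §3.2 (3.5)–(3.6)]); `t` preserves `B` (`i ↦ 2i` permutes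
`ℤ/7`), and `P' := (ker(𝟙_B - t_B))⁰ = (B^{μ₃})⁰` carries the restriction `φ'` of the Hecke element
`η = s + s² + s⁴ - s³ - s⁵ - s⁶` (`τ`-invariant: squares permute the quadratic residues). By
Chevalley–Weil ([ChevalleyWeil1934Integrale]; [LangeRodriguez2022, §2.8, §3 (3.6)]) `H¹(C, ℂ) = 2·1 ⊕ 4·Reg`,
`H^{1,0}(C) = 1 ⊕ 2·Reg`, so `H¹(B) = χ ⊗ M ⊕ χ̄ ⊗ M̄` for the degree-3 irreducible `χ = Ind_N ψ` with
`dim M = 12` of Hodge numbers `(6, 6)`; `η` acts on `χ` by the quadratic Gauss sum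
`ζ + ζ² + ζ⁴ - ζ³ - ζ⁵ - ζ⁶ = i√7`, so `η_B² = -7` and `φ' ≫ φ' = -7`; `H¹(P') = H¹(B)^τ ≅ M ⊕ M̄` has
dimension `24`: `P'` is a TWELVEFOLD on which `ℚ(φ') = ℚ(√-7)` acts with Weil type `(6, 6)`, whence its
Weil plane `⋀¹²_K H¹(P', ℚ)` is a rational plane of `(6,6)`-classes ([Deligne1982HodgeCycles, Prop. 4.4];
[vanGeemen1994HodgeAV, 4.9, Lemma 5.2]) inside the single-operator plane
`Eig((𝟙+φ')^*, (1+i√7)¹²) ⊔ Eig((𝟙+φ')^*, (1-i√7)¹²)`. `P'` is isogenous to the Hecke–Prym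
`Prym(C/μ₃ → C')` of Hecke-algebra theory ([LangeRodriguez2022, §3.5 Cor. 3.5.9–3.5.10];
[CaroccaEtAl2009PrymTyurinHecke]; [Ellenberg2001EndJacobians, §1–2]) — the anchor variety of route
`HeckePrymWeil` of the Hodge summit at `(p, g') = (7, 3)`.

This file records the EXISTENCE of this datum as ONE named fact, `exists_heckePrymDatum_F21`, in the
literal typing in which the cruxes of that route consume it (`Motives.Jacobian`, `Jacobian.pushforward`,
`AbelianVariety.kerComponent`/`kerComponentι`, the single-operator Weil plane on `complexBetti`).

## Rendering (design choices)

* the curve: `C : Motives.SchemeOver ℂ` with `Motives.IsSmoothProjective 1 C`, a Jacobian structure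
  `𝒥 : Motives.Jacobian C` (Albanese property; [Milne1986JacobianVarieties, Thm. 1.1, Prop. 6.1]) with
  `𝒥.J.dim = 43`, automorphisms `σ τ : C ⟶ C` with `σ⁷ = 𝟙`, `τ³ = 𝟙`, `σ ≫ τ = τ ≫ σ ≫ σ` and NO fixed
  complex point (`P ≫ σ ≠ P`, `P ≫ τ ≠ P`; this is all the consumers use of freeness);
* `s`, `t`, `e_N = Σ_{i<7} sⁱ`, the restrictions `s_B`, `t_B` to `B = kerComponent e_N` and `φ'` on
  `P' = kerComponent (𝟙 - t_B)` are bound existentially together with their defining (commutation)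
  equations, exactly as the consumers quantify them;
* Weil type `(6,6)` is witnessed, as everywhere on the route, by a NON-ZERO RATIONAL class of Hodge type
  `(6,6)` in the single-operator Weil plane of `(P', φ')` in `H¹²(P'(ℂ); ℂ)`.

What is NOT here: the algebraicity of the Weil plane of `P'` (Schoen 1988 / Patel–Zhang 2025 for the
cyclic Prym `B` plus the restriction argument — the cruxes' business), the polarization / discriminant of
`P'`, and any uniqueness. The tree constructs no curve of genus `43` with prescribed automorphism group
(no Riemann existence theorem) and no `Jacobian` of a given curve (`Motives.nonempty_jacobian_of_isSmoothProjective`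
is itself a named fact), which is why this is a NAMED FACT.

## References

* [SGA1] A. Grothendieck, SGA 1, Exp. XII Thm. 5.1, Cor. 5.2 (comparison; `π₁` of a curve).
* [ChevalleyWeil1934Integrale] C. Chevalley, A. Weil, Abh. Math. Sem. Hamburg 10 (1934).
* [LangeRodriguez2022] H. Lange, R. E. Rodríguez, LNM 2310 (2022), §2.8, §3.2, §3.5.
* [CaroccaEtAl2009PrymTyurinHecke] Carocca–Lange–Rodríguez–Rojas, Crelle 634 (2009).
* [Ellenberg2001EndJacobians] J. Ellenberg, Adv. Math. 162 (2001), §1–2.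
* [Milne1986JacobianVarieties] J. S. Milne, Jacobian Varieties, Thm. 1.1, Prop. 2.1, Prop. 6.1.
* [Deligne1982HodgeCycles] LNM 900, Prop. 4.4; [vanGeemen1994HodgeAV] LNM 1594, 4.9, Lemma 5.2.
-/

noncomputable section

namespace Literature.AlgebraicGeometry.HodgeTheory

open CategoryTheory
open Literature.AlgebraicGeometry Literature.AlgebraicGeometry.Motives
open Literature.AlgebraicTopology.SingularHomology

/-- **An étale `F₂₁`-cover of a complex genus-3 curve and its Hecke–Prym, a `ℚ(√-7)`-Weil twelvefold
of type `(6,6)`** (NAMED FACT; existence, in the literal typing of the skeleton's datum). There exist a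
smooth projective complex curve `C` with a Jacobian `𝒥` (`Motives.Jacobian`: Albanese property) of
dimension `43` and automorphisms `σ` (order `7`), `τ` (order `3`) with `σ ≫ τ = τ ≫ σ ≫ σ`
(`τ σ τ⁻¹ = σ²`, `F₂₁ = ⟨σ⟩ ⋊ ⟨τ⟩`), both fixed-point free — i.e. an étale Galois `F₂₁`-cover
`C → C' = C/F₂₁` of a genus-3 curve (`2·43 - 2 = 21·(2·3 - 2)`), which exists by Riemann's existence
theorem: `π₁(C')` has the presentation `⟨a₁, b₁, …, a₃, b₃ | ∏[aᵢ, bᵢ]⟩` ([SGA1, Exp. XII Thm. 5.1,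
Cor. 5.2]) and surjects onto `F₂₁` by `a₁ ↦ σ`, `a₂ ↦ τ`, all other generators `↦ 1`; Jacobians exist
([Milne1986JacobianVarieties, Thm. 1.1, Prop. 2.1, Prop. 6.1]). For it, with `s = σ_*`, `t = τ_*` on
`J = 𝒥.J` (`Jacobian.pushforward`), `e_N = Σ_{i<7} sⁱ`, `B = (ker e_N)⁰` (`AbelianVariety.kerComponent`:
the Prym of the cyclic étale cover `C → C/⟨σ⟩` over a genus-7 curve, `dim B = 43 - 7 = 36`,
[LangeRodriguez2022, §3.2 (3.5)–(3.6)]), `s_B`, `t_B` the restrictions of `s`, `t` to `B` (`t e_N = e_N t`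
since `i ↦ 2i` permutes `ℤ/7`), `P' = (ker(𝟙_B - t_B))⁰` and `φ'` the restriction to `P'` of the Hecke
element `η_B = s_B + s_B² + s_B⁴ - s_B³ - s_B⁵ - s_B⁶`: `dim P' = 12`, `φ' ≫ φ' = -7`, and `P'` carries a
NON-ZERO RATIONAL `(6,6)`-class in `Eig((𝟙+φ')^*, (1+i√7)¹²) ⊔ Eig((𝟙+φ')^*, (1-i√7)¹²)` (`(P', ℚ(φ'))`
is of Weil type `(6,6)`). WHY: Chevalley–Weil for the étale `F₂₁`-cover gives
`H¹(C, ℚ) ⊗ ℂ = 2·1 ⊕ 4·Reg` and `H^{1,0}(C) = 1 ⊕ 2·Reg` ([ChevalleyWeil1934Integrale];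
[LangeRodriguez2022, §2.8, §3 (3.6)]), so `H¹(B) = χ ⊗ M ⊕ χ̄ ⊗ M̄` for the degree-3 irreducible
`χ = Ind ψ` with `dim M = 12` of Hodge numbers `(6,6)`; `η` acts on `χ` by the quadratic Gauss sum
`ζ+ζ²+ζ⁴-ζ³-ζ⁵-ζ⁶ = i√7`, so `φ' ≫ φ' = -7`; `H¹(P') = H¹(B)_τ` (coinvariants) has dimension `24`,
`dim P' = 12`, `(P', φ')` is of Weil type `(6,6)` and `⋀¹²_K H¹(P', ℚ)` is a rational plane of
`(6,6)`-classes, which is the single-operator Weil plane ([vanGeemen1994HodgeAV, 4.9, Lemma 5.2 and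
proof of Thm. 6.12]; [Deligne1982HodgeCycles, Prop. 4.4]); `P'` is isogenous to the Hecke–Prym
`Prym(C/μ₃ → C/F₂₁)` of the route ([LangeRodriguez2022, §3.5 Cor. 3.5.9–3.5.10];
[CaroccaEtAl2009PrymTyurinHecke]; [Ellenberg2001EndJacobians, §1–2]). The tree constructs no curve of
genus `43` with prescribed automorphism group (no Riemann existence theorem) and no `Jacobian` of a
given curve, which is why this is a NAMED FACT. [cite: SGA1, Exp. XII Thm. 5.1 and Cor. 5.2]
[cite: Milne1986JacobianVarieties, Thm. 1.1, Prop. 2.1 and Prop. 6.1]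
[cite: ChevalleyWeil1934Integrale, Satz (pp. 358–361)]
[cite: LangeRodriguez2022, §2.8, §3.2 (3.5)–(3.6) and §3.5 Cor. 3.5.9–3.5.10]
[cite: CaroccaEtAl2009PrymTyurinHecke, §1] [cite: vanGeemen1994HodgeAV, 4.9, Lemma 5.2 and Thm. 6.12]
-/
def exists_heckePrymDatum_F21 : Prop :=
  ∃ (C : SchemeOver ℂ) (𝒥 : Jacobian C) (σ τ : C ⟶ C) (s t eN : 𝒥.J ⟶ 𝒥.J)
    (sB tB : AbelianVariety.kerComponent eN ⟶ AbelianVariety.kerComponent eN)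
    (φ' : AbelianVariety.kerComponent (𝟙 (AbelianVariety.kerComponent eN) - tB) ⟶
      AbelianVariety.kerComponent (𝟙 (AbelianVariety.kerComponent eN) - tB)),
    IsSmoothProjective 1 C ∧ 𝒥.J.dim = 43 ∧
    σ ≫ σ ≫ σ ≫ σ ≫ σ ≫ σ ≫ σ = 𝟙 C ∧ τ ≫ τ ≫ τ = 𝟙 C ∧ σ ≫ τ = τ ≫ σ ≫ σ ∧
    (∀ P : ComplexPoints C, P ≫ σ ≠ P ∧ P ≫ τ ≠ P) ∧
    s = 𝒥.pushforward 𝒥 σ ∧ t = 𝒥.pushforward 𝒥 τ ∧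
    eN = 𝟙 𝒥.J + s + s ≫ s + s ≫ s ≫ s + s ≫ s ≫ s ≫ s + s ≫ s ≫ s ≫ s ≫ s +
      s ≫ s ≫ s ≫ s ≫ s ≫ s ∧
    sB ≫ AbelianVariety.kerComponentι eN = AbelianVariety.kerComponentι eN ≫ s ∧
    tB ≫ AbelianVariety.kerComponentι eN = AbelianVariety.kerComponentι eN ≫ t ∧
    φ' ≫ AbelianVariety.kerComponentι (𝟙 (AbelianVariety.kerComponent eN) - tB) =
      AbelianVariety.kerComponentι (𝟙 (AbelianVariety.kerComponent eN) - tB) ≫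
        (sB + sB ≫ sB + sB ≫ sB ≫ sB ≫ sB - sB ≫ sB ≫ sB - sB ≫ sB ≫ sB ≫ sB ≫ sB -
          sB ≫ sB ≫ sB ≫ sB ≫ sB ≫ sB) ∧
    (AbelianVariety.kerComponent (𝟙 (AbelianVariety.kerComponent eN) - tB)).dim = 12 ∧
    φ' ≫ φ' = -((7 : ℤ) • 𝟙 (AbelianVariety.kerComponent (𝟙 (AbelianVariety.kerComponent eN) - tB))) ∧
    ∃ c : complexBetti (AbelianVariety.kerComponent (𝟙 (AbelianVariety.kerComponent eN) - tB)).X 12,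
      c ≠ 0 ∧ IsRationalClass c ∧
      IsOfHodgeType 12 (AbelianVariety.kerComponent (𝟙 (AbelianVariety.kerComponent eN) - tB)).X 12 6 6 c ∧
      c ∈ Module.End.eigenspace (complexBetti.map
              (𝟙 (AbelianVariety.kerComponent (𝟙 (AbelianVariety.kerComponent eN) - tB)) + φ').hom.hom.hom
              12).hom ((1 + Complex.I * (Real.sqrt (7 : ℝ) : ℂ)) ^ 12) ⊔
          Module.End.eigenspace (complexBetti.map
              (𝟙 (AbelianVariety.kerComponent (𝟙 (AbelianVariety.kerComponent eN) - tB)) + φ').hom.hom.hom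
              12).hom ((1 - Complex.I * (Real.sqrt (7 : ℝ) : ℂ)) ^ 12)

end Literature.AlgebraicGeometry.HodgeTheory

end
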